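/-
Copyright (c) 2026 the pub-hodgecm-mathlib formalisation cell (harness21).  Prover seat hodgecm-mathlib-LH4-p15 (g2), req620 Track A «(D-RAM) FOUR-FRAME» squad
(STAGE-1b, row (2) of the piece `f_{T₊}`, the (β₂) road (R-36) «PURE-CELL LEDGER»; β₂ sub-dealer LH4-p04 (g10) WORD #24 letter ‹TERM.letter.v2› 78b8538f5e7a241e, holder LH4-p15 (g2)),
2026-09-05.
-/
import Summits.HodgeConjecture.HodgeConjecture.Theorems.F0P3cDyRamTerminalCellFibres        -- ★ (this seat): (hI), (hF), the glued vertex over a weighted member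
import Summits.HodgeConjecture.HodgeConjecture.Theorems.F0P3cDyRamTerminalCellReads         -- ★ (this seat): the three reads at the given generator
import Summits.HodgeConjecture.HodgeConjecture.Theorems.F0P3cDyRamConeCellCountSocketThree  -- ★ p863833 (LH4-p19 (g2)): the three-way count socket
import Summits.HodgeConjecture.HodgeConjecture.Theorems.F0P3cDyRamShellOfExactLevel         -- ★ (LH7-p09 (g2), FILE 10): the fold «shell = exact level under the product letter»
import Summits.HodgeConjecture.HodgeConjecture.Theorems.F0P3cDyRamBeta2ConesRowWindow        -- ★ p863007 (LH7-p10 (g2)): `isOrd_lam_iff_le`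
import Summits.HodgeConjecture.HodgeConjecture.Theorems.F0P3cDyRamDiagonalFixedClassSystems  -- ★ (LH4 lineage): `exists_repr_fixedBall_card` (digit systems)
import Summits.HodgeConjecture.HodgeConjecture.Theorems.F0P3cDyRamConeCellLedgerSizes        -- ★ p861334 (LH4-p19): `levelSetDep_eq_levelSet_of_add_le`
import Summits.HodgeConjecture.HodgeConjecture.Theorems.F0P3cDyRamToricLevelCensusRamKAtThirdField  -- ★ (LH4-p14): `forall_fixed_fixed_exists_mul_theta_eq_of_frame` (`hFN`)
import Literature.NumberTheory.LocalFields.WildQuadraticDatumNormSignConductor               -- ★ Lit: `exists_mul_map_eq_of_fixed_of_v_sub_one_le_pred` (the norm-depth law)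
import HarnessLib
/-!
# Crux `H413`, line LH4 «(D-RAM) FOUR-FRAME» — STAGE-1b, row (2), the (β₂) road (R-36), lane B: «THE OFF-DIAGONAL TERMINAL CELL CONTRIBUTES ZERO» in ‹OFF.letter.v1›'s
# currency — `term_holds (N) (hN)` = the letter ‹TERM.letter.v2› (78b8538f5e7a241e) of the β₂ sub-dealer LH4-p04 (g10), the hypothesis `hterm` of ★ p863974 `hft_of_pieces`
# and of ★ `small2_of_term_of_dflat₂`

Cell `hodgecm-mathlib` (D-0151), FLOOR 0, crux item H413 = `stmt-HodgeConjecture-24833`, route of record `HCCMUnconditional`; squad F0∕P3c∕LH4; lane `--supports stmt-HodgeConjecture-24833 --as helper` (count-neutral; pays NO tier-0 row).  THEOREMS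
ONLY (no `def`, no instance, no notation, no `sorry`, default heartbeats); ★-only imports; states NO law; (β₂) stays a HYPOTHESIS.  CONCLUSION = ‹OFF.letter.v1›'s one-literal general block (binders byte-identical to ★ p863420's `hterm` binder) with
the tail `∀ b j, 1 ≤ b → 2 * b = m → d = 2 → tE < m → 4 ≤ m → b < j → j + b = jl → X(j,b) = 0` (‹TERM.letter.v2› = ‹TERM.v1› with the single token `b ≤ j ↦ b < j`; the diagonal `δ = 0` is FALSE, cdis1 (g0) LEDGERCHECK.v2 keys (8,8), (10,10), and is
LH4-p06's ‹D0› road) — universally closed over the fence schema `N` with the ONE floor hypothesis `hN : ∀ d tE q, 4 ≤ N d tE q`.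
WHY (this seat's (ROW-TERM) series ★ p863722 · p863845 · p863899 · p863952 · p864020 · p864194 · (T-b5a) · (T-b5b); LH4-p19 (g2)'s three-way socket ★ p863833; LH4-p16 (g2)'s row-cell reads ★ p863914 and sphere transport; LH7-p09 (g2)'s fold ★
`…ShellOfExactLevel`).  On the terminal cell `(j, b)` (`j = b + δ`, `δ = jl − m ≥ 2` even) the two shells `(0, m*)`, `(0, m_c)` are the exact level `0` (fold, `k = 3, 4`); per glued vertex (★ p862869 presentation) ★ p864194 reads level `0`, `¬`level
`1` ⟺ `NX(V) :≡ |α₁ + γ₁V| = 1`, and the value set as `ω(pw·P)·ω(α₁ + γ₁V)`; on populated members `ω(pw·P) = ω(−h_W)` (★ p863914 §3) and the digit moves to the given generator (★ p863952 + parity), so (hL₁)(hL₂) hold with `ψ :≡ NX ∧ ω(α₁ + γ₁·) =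
ω(−h_W)`; (hP), (hV) are ★ p863914's; (hI) is ★ p863952; `LIT :≡` «on the sphere and realisable from a vertex» gives (hLit) (★ T-b5b §2), (hF) (★ T-b5b §1, §4 + ★ `ncard_fibre_eq_ncard_fibre_of_sphere`), and is constant on `|V − V′| ≤ |ϖ|²` (★ T-b5b
§3), so (hbase) is ★ p863899 HEAD′; every weighted member carries a glued vertex (★ `ncard_glueFibre_eq_natCard_normFibre_of_gen` + `hf`).  ★ p863833 then gives `X(j,b) = 0` — for EVERY residue cardinality `q` (★ p863722's `q = 2` shortcut is not
needed).
Constants: `θ₀ := αΘα`, `κ₀ := θ₀∕(θ₀ − ρθ₀)`, `ξ₀ := jE((ϖσϖ)^{δ∕2})⁻¹·(θ₀ − ρθ₀)` (`δ` even by ★ `antiDepth_mod_two_eq`), `μ = jE μ_a + jE μ_b·α`, `R₀, γ₀` (★ p862871), `P = (ϖσϖ)^b`, `â = (μ_a + μ_b R₀)∕P`, `b̂ = μ_b γ₀∕P` (`|â| ≤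
1`, `|b̂| = 1`), `α₁, γ₁` (★ p864020), the digit systems `R_d` (`2d`) and `R′` (`2`) (★ `exists_repr_fixedBall_card`), `hFN` (★ `forall_fixed_fixed_exists_mul_theta_eq_of_frame`), `hN4` (★ Lit norm-depth law on the `Θ`-datum at `n = 3
≥ 2d − 1`).
* HEAD `term_holds` ((hI), (hF), the glued vertex and the per-generator reads are ★ `…TerminalCellFibres` ∕ ★ `…TerminalCellReads`, split out per declaration).
HONEST LABEL.  Count-neutral assembly; nothing printed is asserted; no census law is stated; `HC_CM` is proved only modulo the 7 printed citations (2 remaining named inputs: hLiu418 =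
`stmt-HodgeConjecture-24832`, h413 = `stmt-HodgeConjecture-24833`) until rung 0 closes.
## References
* [Kottwitz1986BaseChangeUnits] R. E. Kottwitz, *Base change for unit elements of Hecke algebras*, Compositio Math. 60 (1986): §1 pp. 240–241, §3; [LabesseLanglands1979] J.-P. Labesse, R. P. Langlands, Canad. J. Math. 31 (1979): §2 (2.2) p. 9.
* [Rogawski1990] J. D. Rogawski, *Automorphic Representations of Unitary Groups in Three Variables*, Ann. of Math. Stud. 123 (1990): §4.9 Prop. 4.9.1 (b) p. 55, §12.2; [Jacobowitz1962] R. Jacobowitz, Amer. J. Math. 84 (1962): §4.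
* [Serre1979] J.-P. Serre, *Local Fields*, GTM 67 (1979): Ch. III §6 Prop. 12; Ch. V §2 Prop. 3, §3 Cor. 3 pp. 84–86; Ch. XV §2.
-/
set_option autoImplicit false
noncomputable section
namespace Summit.HodgeConjecture.HodgeConjecture.Cruxes.H413.F0P3cDyRamTermHolds
open scoped Matrix MatrixGroups Classical Valued WithZero
open WithZero
open Literature.NumberTheory.Automorphic Literature.NumberTheory.Automorphic.UnitaryThreeFourFrame Literature.NumberTheory.Automorphic.UnitaryLatticeTree
open Literature.NumberTheory.Automorphic.HermitianLattice Literature.NumberTheory.Automorphic.EllipticPlaneAsFieldLine Literature.NumberTheory.LocalFields.QuadraticOrder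
open Literature.NumberTheory.Rogawski1990
open Literature.NumberTheory.LocalFields (isAdicComplete_valuedInteger_of_completeSpace)
open Literature.NumberTheory.LocalFields.ValuedEmbedding (v_le_uniformizer_of_lt_one)
open Literature.NumberTheory.LocalFields.WildQuadraticDatum (exists_mul_map_eq_of_fixed_of_v_sub_one_le_pred)
open Summit.HodgeConjecture.HodgeConjecture.Cruxes.H413.F0P3cDyRamToricCensusDefs Summit.HodgeConjecture.HodgeConjecture.Cruxes.H413.F0P3cDyRamFourFramePieces Summit.HodgeConjecture.HodgeConjecture.Cruxes.H413.F0P3cDyRamFourFrameCensusDefs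
open Summit.HodgeConjecture.HodgeConjecture.Cruxes.H413.F0P3cDyRamStageOneBDefs
open Summit.HodgeConjecture.HodgeConjecture.Cruxes.H413
open Summit.HodgeConjecture.HodgeConjecture.Cruxes.H413.F0P3cDyRamRowCellOnShell Summit.HodgeConjecture.HodgeConjecture.Cruxes.H413.F0P3cDyRamRowCleanCellBit Summit.HodgeConjecture.HodgeConjecture.Cruxes.H413.F0P3cDyRamBeta2ConesRowWindow
open Summit.HodgeConjecture.HodgeConjecture.Cruxes.H413.F0P3cDyRamToricLevelCensusRamKAtThirdField Summit.HodgeConjecture.HodgeConjecture.Cruxes.H413.F0P3cDyRamConeCellLedgerSizes Summit.HodgeConjecture.HodgeConjecture.Cruxes.H413.F0P3cDyRamDiagonalFixedClassSystems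
open Summit.HodgeConjecture.HodgeConjecture.Cruxes.H413.F0P3cDyRamDiagonalCellCoordinates Summit.HodgeConjecture.HodgeConjecture.Cruxes.H413.F0P3cDyRamRowVertexAffineCoordinate Summit.HodgeConjecture.HodgeConjecture.Cruxes.H413.F0P3cDyRamRowCellSocketReads
open Summit.HodgeConjecture.HodgeConjecture.Cruxes.H413.F0P3cDyRamNormPairsIffFrames Summit.HodgeConjecture.HodgeConjecture.Cruxes.H413.F0P3cDyRamShellOfExactLevel Summit.HodgeConjecture.HodgeConjecture.Cruxes.H413.F0P3cDyRamConeCellCountSocketThree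
open Summit.HodgeConjecture.HodgeConjecture.Cruxes.H413.F0P3cDyRamUnitAffineDigitCount Summit.HodgeConjecture.HodgeConjecture.Cruxes.H413.F0P3cDyRamAffineLabelDepthZero Summit.HodgeConjecture.HodgeConjecture.Cruxes.H413.F0P3cDyRamTerminalCellSocketLetters
open Summit.HodgeConjecture.HodgeConjecture.Cruxes.H413.F0P3cDyRamTerminalCellFibres Summit.HodgeConjecture.HodgeConjecture.Cruxes.H413.F0P3cDyRamTerminalCellReads

/-- **HEAD — ‹TERM.letter.v2› HOLDS: «THE OFF-DIAGONAL TERMINAL CELL CONTRIBUTES ZERO»** (‹OFF.letter.v1›'s one-literal general block; tail `∀ b j, 1 ≤ b → 2b = m → d = 2 → tE < m →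
4 ≤ m → b < j → j + b = jl → X(j,b) = 0`; `N` the fence schema with the floor `4 ≤ N`).  ★ p863833 ∘ fold ∘ (★ p864194 per vertex, ★ p863914, ★ p863952, ★ p863899, ★ T-b5b).
[cite: Kottwitz1986BaseChangeUnits, §1 pp. 240–241; §3] [cite: Rogawski1990, §4.9 Prop. 4.9.1 (b) p. 55] [cite: LabesseLanglands1979, §2 (2.2) p. 9] [cite: Jacobowitz1962, §4] -/
theorem term_holds (N : ℕ → ℕ → ℕ → ℕ) (hN : ∀ d tE q : ℕ, 4 ≤ N d tE q) :
      ∀ (E M : Type) [Field E] [Valued E ℤᵐ⁰] [CompleteSpace E] [IsDiscreteValuationRing 𝒪[E]] [Finite 𝓀[E]]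
        [Field M] [Valued M ℤᵐ⁰] [CompleteSpace M] [IsDiscreteValuationRing 𝒪[M]] [Finite 𝓀[M]]
        (σ : E →+* E) (ϖ : E) (d tE : ℕ) (_hD : IsRamifiedQuadraticDatum σ ϖ d tE) (_hσσ : ∀ a, σ (σ a) = a) (_h2 : ¬ IsUnit (2 : 𝒪[E]))
        (jE : E →+* M) (ρ Θ : M →+* M) (α lam : M)
        (_hρρ : ∀ z, ρ (ρ z) = z) (_hvρ : ∀ z, Valued.v (ρ z) = Valued.v z) (_hρj : ∀ a, ρ (jE a) = jE a)
        (_hjv : ∀ a, Valued.v (jE a) ≤ 1 ↔ Valued.v a ≤ 1) (_hjfix : ∀ z : M, ρ z = z ↔ ∃ a, jE a = z) (_hΘj : ∀ a, Θ (jE a) = jE (σ a))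
        (_hΘΘ : ∀ z, Θ (Θ z) = z) (_hΘρ : ∀ z, Θ (ρ z) = ρ (Θ z)) (_hvΘ : ∀ z, Valued.v (Θ z) = Valued.v z)
        (_hα : ρ α ≠ α) (_hα1 : Valued.v α ≤ 1) (_hint : ∀ z : M, Valued.v z ≤ 1 → Valued.v ((z - ρ z) / (α - ρ α)) ≤ 1)
        (_hΘlam : Θ lam * lam = 1) (_hvlam : Valued.v lam = 1) (_hbasis : ∀ z : M, ∃! pq : E × E, z = jE pq.1 + jE pq.2 * lam)
        (_hU : Valued.v (α - ρ α) = 1) (_hτ : Valued.v (α - Θ α) < 1)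
        (_hσres : ∀ z : M, ρ z = z → Valued.v z ≤ 1 → Valued.v (Θ z - z) < 1) (_hres : ∀ z : M, Valued.v z ≤ 1 → Valued.v (z - Θ z) < 1)
        (_hΘne : ∃ x : M, Θ x ≠ x) (_hDM : IsRamifiedQuadraticDatum Θ (jE ϖ) d tE) (_hjiso : ∀ a, Valued.v (jE a) = Valued.v a)
        (_hq : Nat.card 𝓀[M] = Nat.card 𝓀[E] ^ 2) (_hjpow : ∀ (t : E) (n : ℤ), Valued.v (jE t) = Valued.v (jE ϖ) ^ n ↔ Valued.v t = Valued.v ϖ ^ n)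
        (_hEval : ∀ c : M, ρ c = c → c ≠ 0 → Valued.v c ≤ 1 → ∃ n : ℕ, Valued.v c = Valued.v (jE ϖ) ^ n)
        (_hϖmax : ∀ t : M, ρ t = t → Valued.v t < 1 → Valued.v t ≤ Valued.v (jE ϖ))
        (γ₂ : GL (Fin 2) E) (u : GL (Fin 1) E)
        (_hdet : (γ₂ : Matrix (Fin 2) (Fin 2) E).det * σ (γ₂ : Matrix (Fin 2) (Fin 2) E).det = 1)
        (_htr : (γ₂ : Matrix (Fin 2) (Fin 2) E).trace = (γ₂ : Matrix (Fin 2) (Fin 2) E).det * σ (γ₂ : Matrix (Fin 2) (Fin 2) E).trace)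
        (_hirr : ∀ x : E, x * x - (γ₂ : Matrix (Fin 2) (Fin 2) E).trace * x + (γ₂ : Matrix (Fin 2) (Fin 2) E).det ≠ 0)
        (_hlam2 : lam * lam = jE (γ₂ : Matrix (Fin 2) (Fin 2) E).trace * lam - jE (γ₂ : Matrix (Fin 2) (Fin 2) E).det)
        (_hρlam : ρ lam = jE (γ₂ : Matrix (Fin 2) (Fin 2) E).trace - lam) (m jl : ℕ) (_hm : Valued.v (lam - jE ((u : Matrix (Fin 1) (Fin 1) E) 0 0)) = WithZero.exp (-(m : ℤ)))
        (_hjl : Valued.v ((lam - jE ((u : Matrix (Fin 1) (Fin 1) E) 0 0)) - ρ (lam - jE ((u : Matrix (Fin 1) (Fin 1) E) 0 0))) = WithZero.exp (-(jl : ℤ)))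
        (_hs : Valued.v ((γ₂ : Matrix (Fin 2) (Fin 2) E).trace - 2) * Valued.v (ϖ ^ (d % 2)) ≤ Valued.v (ϖ ^ mcOfRecord d))
        (_hp : Valued.v ((γ₂ : Matrix (Fin 2) (Fin 2) E).det - (γ₂ : Matrix (Fin 2) (Fin 2) E).trace + 1) ≤ Valued.v (ϖ ^ mcOfRecord d))
        (_hNm : N d tE (Nat.card 𝓀[E]) ≤ m) (_hu1N : Valued.v (((u : Matrix (Fin 1) (Fin 1) E) 0 0) - 1) ≤ Valued.v (ϖ ^ N d tE (Nat.card 𝓀[E]))) (_hlam1 : Valued.v (lam - 1) ≤ Valued.v (jE ϖ ^ N d tE (Nat.card 𝓀[E])))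
        (_hu : Valued.v ((u : Matrix (Fin 1) (Fin 1) E) 0 0) = 1) (_hum : Valued.v (((u : Matrix (Fin 1) (Fin 1) E) 0 0) - 1) ≤ Valued.v (ϖ ^ mstarOfRecord d))
        (H₂ : Matrix (Fin 2) (Fin 2) E) (hW : E) (_hH₂ : IsUnit H₂.det) (_hH₂σ : (H₂.map σ)ᵀ = H₂) (_hhW : Valued.v hW = 1) (_hhWσ : σ hW = hW)
        (P₁ : GL (Fin 3) E) (_hA : formCongr σ P₁ ((StdForm.antidiagonal 3).over E) = (!![H₂ 0 0, 0, H₂ 0 1; 0, hW, 0; H₂ 1 0, 0, H₂ 1 1] : Matrix (Fin 3) (Fin 3) E))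
        (_hΓ : P₁ * endoGL (γ₂, u) * P₁⁻¹ ∈ unitaryGroupOfForm σ ((StdForm.antidiagonal 3).over E))
        (φ : (Fin 2 → E) →+ M) (h : M) (_hφs : ∀ (c : E) (x : Fin 2 → E), φ (c • x) = jE c * φ x) (_hφi : Function.Injective φ) (_hφo : Function.Surjective φ)
        (_hφγ : ∀ x, φ ((γ₂ : Matrix (Fin 2) (Fin 2) E).mulVec x) = lam * φ x)
        (_hform : ∀ x y, jE (pairing σ H₂ x y) = h * Θ (φ x) * φ y + ρ (h * Θ (φ x) * φ y)) (_hΘh : Θ h = h) (_hh : h ≠ 0)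
        (J R : ℕ) (f : ℕ → ℕ → AddSubgroup M → ℕ)
        (_hfinF : {L₃ : Submodule 𝒪[E] (Fin 3 → E) | IsSelfDualLattice σ ϖ (!![H₂ 0 0, 0, H₂ 0 1; 0, hW, 0; H₂ 1 0, 0, H₂ 1 1] : Matrix (Fin 3) (Fin 3) E) L₃ ∧ mapGL (endoGL (γ₂, u)) L₃ = L₃}.Finite)
        (_hR : ∀ L₃ : Submodule 𝒪[E] (Fin 3 → E), IsSelfDualLattice σ ϖ (!![H₂ 0 0, 0, H₂ 0 1; 0, hW, 0; H₂ 1 0, 0, H₂ 1 1] : Matrix (Fin 3) (Fin 3) E) L₃ →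
          mapGL (endoGL (γ₂, u)) L₃ = L₃ → ∀ b : ℕ, (∀ c : E, (Pi.single 1 c : Fin 3 → E) ∈ L₃ ↔ Valued.v c ≤ Valued.v ϖ ^ b) → b ≤ R)
        (_hJ : ¬ IsOrd ρ α (jE ϖ ^ (J + 1)) lam) (_hfinLS : ∀ j a, (levelSet ρ Θ α (jE ϖ) h j a).Finite)
        (_hf : ∀ (b j : ℕ) (Λ : AddSubgroup M) (x₀ : M) (r : E), 1 ≤ b → x₀ ≠ 0 → (∀ x, x ∈ Λ ↔ ∃ z, IsOrd ρ α (jE ϖ ^ j) z ∧ x = x₀ * z) →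
          IsOrd ρ α (jE ϖ ^ j) (dualGen ρ Θ α (jE ϖ ^ j) h x₀) → ¬ IsOrd ρ α (jE ϖ ^ j) (dualGen ρ Θ α (jE ϖ ^ j) h x₀ / jE ϖ) → Valued.v (dualGen ρ Θ α (jE ϖ ^ j) h x₀) = Valued.v (jE ϖ) ^ b →
          (∀ b', (∀ x ∈ Λ, Valued.v (h * Θ x * b' + ρ (h * Θ x * b')) ≤ 1) → (lam - jE ((u : Matrix (Fin 1) (Fin 1) E) 0 0)) * b' ∈ Λ) → IsOrd ρ α (jE ϖ ^ j) lam →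
          jE r = glueUnit ρ Θ α (jE ϖ ^ j) h (jE ϖ) (jE hW) x₀ b →
          f b j Λ = Nat.card {x : 𝒪[E] ⧸ 𝓂[E] ^ (2 * b) // ∃ u' : 𝒪[E], Ideal.Quotient.mk (𝓂[E] ^ (2 * b)) u' = x ∧ Valued.v ((u' : E) * σ u' - r) ≤ Valued.v (ϖ ^ (2 * b))}),
        ∀ b j : ℕ, 1 ≤ b → 2 * b = m → d = 2 → tE < m → 4 ≤ m → b < j → j + b = jl →
                ((∑ᶠ Λ ∈ levelSetDep ρ Θ α (jE ϖ) h j b (lam - jE ((u : Matrix (Fin 1) (Fin 1) E) 0 0)) ∩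
                      {Λ | ∃ B : Submodule 𝒪[E] (Fin 2 → E), B.toAddSubgroup.map φ = Λ ∧
                        ∃ L₃ : Submodule 𝒪[E] (Fin 3 → E), IsSelfDualLattice σ ϖ (!![H₂ 0 0, 0, H₂ 0 1; 0, hW, 0; H₂ 1 0, 0, H₂ 1 1] : Matrix (Fin 3) (Fin 3) E) L₃ ∧
                          L₃ ⊓ LinearMap.ker ((LinearMap.proj (1 : Fin 3) : (Fin 3 → E) →ₗ[E] E).restrictScalars 𝒪[E]) =
                            B.map ((Matrix.toLin' (!![1, 0; 0, 0; 0, 1] : Matrix (Fin 3) (Fin 2) E)).restrictScalars 𝒪[E]) ∧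
                          (∀ c : E, (Pi.single 1 c : Fin 3 → E) ∈ L₃ ↔ Valued.v c ≤ Valued.v ϖ ^ b) ∧
                          (LatticeNearTransvShell ϖ (d % 2) (mstarOfRecord d) ((((endoGL (γ₂, u) : GL (Fin 3) E) : Matrix (Fin 3) (Fin 3) E) - 1)) L₃ ∧
                            {z : E | ∃ y ∈ L₃, Valued.v ((ϖ ^ (mstarOfRecord d))⁻¹ * (z - pairing σ (!![H₂ 0 0, 0, H₂ 0 1; 0, hW, 0; H₂ 1 0, 0, H₂ 1 1] : Matrix (Fin 3) (Fin 3) E) y (((((endoGL (γ₂, u) : GL (Fin 3) E) : Matrix (Fin 3) (Fin 3) E) - 1)) *ᵥ y))) ≤ 1} =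
                              valueSetMod σ ϖ (mstarOfRecord d) (xPlus σ ϖ d))}, f b j Λ : ℕ) : ℤ) -
                  ((∑ᶠ Λ ∈ levelSetDep ρ Θ α (jE ϖ) h j b (lam - jE ((u : Matrix (Fin 1) (Fin 1) E) 0 0)) ∩
                      {Λ | ∃ B : Submodule 𝒪[E] (Fin 2 → E), B.toAddSubgroup.map φ = Λ ∧
                        ∃ L₃ : Submodule 𝒪[E] (Fin 3 → E), IsSelfDualLattice σ ϖ (!![H₂ 0 0, 0, H₂ 0 1; 0, hW, 0; H₂ 1 0, 0, H₂ 1 1] : Matrix (Fin 3) (Fin 3) E) L₃ ∧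
                          L₃ ⊓ LinearMap.ker ((LinearMap.proj (1 : Fin 3) : (Fin 3 → E) →ₗ[E] E).restrictScalars 𝒪[E]) =
                            B.map ((Matrix.toLin' (!![1, 0; 0, 0; 0, 1] : Matrix (Fin 3) (Fin 2) E)).restrictScalars 𝒪[E]) ∧
                          (∀ c : E, (Pi.single 1 c : Fin 3 → E) ∈ L₃ ↔ Valued.v c ≤ Valued.v ϖ ^ b) ∧
                          (LatticeNearTransvShell ϖ (d % 2) (mcOfRecord d) ((((endoGL (γ₂, u) : GL (Fin 3) E) : Matrix (Fin 3) (Fin 3) E) - 1)) L₃ ∧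
                            ¬ {z : E | ∃ y ∈ L₃, Valued.v ((ϖ ^ (mstarOfRecord d))⁻¹ * (z - pairing σ (!![H₂ 0 0, 0, H₂ 0 1; 0, hW, 0; H₂ 1 0, 0, H₂ 1 1] : Matrix (Fin 3) (Fin 3) E) y (((((endoGL (γ₂, u) : GL (Fin 3) E) : Matrix (Fin 3) (Fin 3) E) - 1)) *ᵥ y))) ≤ 1} =
                              valueSetMod σ ϖ (mstarOfRecord d) (xPlus σ ϖ d))}, f b j Λ : ℕ) : ℤ) = 0 := by
  intro E M _ _ _ _ _ _ _ _ _ _ σ ϖ d tE hD hσσ h2 jE ρ Θ α lam hρρ hvρ hρj hjv hjfix hΘj hΘΘ hΘρ hvΘ hα hα1 hint hΘlam hvlam hbasis hU hτ hσres hres hΘne hDM hjiso hq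
    hjpow hEval hϖmax γ₂ u hdet htr hirr hlam2 hρlam m jl hm hjl hs hp hNm hu1N hlam1 hu hum H₂ hW hH₂ hH₂σ hhW hhWσ P₁ hA hΓ φ h hφs hφi hφo hφγ hform hΘh hh
    J R f hfinF hR hJ hfinLS hf b j hb hbm hd2 htE h4m hbj hjb
  subst hd2
  haveI : Nonempty 𝓀[E] := ⟨0⟩
  -- ### E-side letters
  obtain ⟨-, hvσ, hϖ, hfixE, hdd, hd1, h2t⟩ := id hD
  haveI := isAdicComplete_valuedInteger_of_completeSpace (K := E) hϖ
  obtain ⟨hϖ0, hϖlt, hjϖ0, hvjϖ0, -, hjϖlt, hjϖle⟩ := uniformizer_letters jE hjv hϖ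
  have hvϖ0 : Valued.v ϖ ≠ 0 := (Valuation.ne_zero_iff _).2 hϖ0
  have h2v : Valued.v (2 : E) < 1 := by exact_mod_cast Valuation.Integer.not_isUnit_iff_valuation_lt_one.mp h2
  have h2M : Valued.v (2 : M) < 1 := by have e := hjiso 2; rw [map_ofNat] at e; rw [e]; exact h2v
  have hϖM : Valued.v (jE ϖ) = exp (-1 : ℤ) := by rw [hjiso, hϖ]
  have hπn : ∀ n : ℕ, Valued.v (jE ϖ) ^ n = exp (-(n : ℤ)) := fun n => by rw [hϖM, ← exp_nsmul, nsmul_eq_mul, mul_neg, mul_one]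
  have hπz : ∀ n : ℤ, exp n = Valued.v (jE ϖ) ^ (-n) := fun n => by rw [hϖM, ← exp_zsmul, smul_eq_mul, mul_neg, mul_one, neg_neg]
  have hρϖ : ρ (jE ϖ) = jE ϖ := hρj ϖ
  have hW0 : hW ≠ 0 := fun h0 => by rw [h0, map_zero] at hhW; exact zero_ne_one hhW
  have hhW1 : Valued.v (jE hW) = 1 := by rw [hjiso, hhW]
  have hd0 : (2 : ℕ) % 2 = 0 := by decide
  have huu := line_entry_mul_map_eq_one σ hW0 hA hΓ
  have hα0 : α - ρ α ≠ 0 := fun h0 => by rw [h0, map_zero] at hU; exact zero_ne_one hU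
  -- cell arithmetic: `δ = j − b ≥ 1`, `b ≥ 2`, `d = 2 ≤ b`
  have hdb : 2 ≤ b := by omega
  have hjb' : j + b ≤ jl := by omega
  have h2b : 2 * b ≤ m := by omega
  have hlamj : IsOrd ρ α (jE ϖ ^ j) lam := (isOrd_lam_iff_le (u := u) hD hρj hvlam hU hjiso hjl j).2 (by omega)
  have hcell : levelSetDep ρ Θ α (jE ϖ) h j b (lam - jE ((u : Matrix (Fin 1) (Fin 1) E) 0 0)) = levelSet ρ Θ α (jE ϖ) h j b :=
    levelSetDep_eq_levelSet_of_add_le hρρ hvρ hΘΘ hΘρ hvΘ hα1 hU hρϖ hϖM hh hm hjl hb h2b hjb'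
  have hfin : (levelSet ρ Θ α (jE ϖ) h j b).Finite := hfinLS j b
  have hc : ρ (jE ϖ ^ j) = jE ϖ ^ j := by rw [map_pow, hρϖ]
  have hc0 : jE ϖ ^ j ≠ 0 := pow_ne_zero _ hjϖ0
  have hc1 : Valued.v (jE ϖ ^ j) ≤ 1 := by rw [Valuation.map_pow]; exact pow_le_one₀ zero_le hjϖle
  have hclt : Valued.v (jE ϖ ^ j) < 1 := by rw [Valuation.map_pow]; exact pow_lt_one₀ zero_le hjϖlt (by omega)
  have hcc : jE ϖ ^ j * (α - ρ α) ≠ 0 := mul_ne_zero hc0 hα0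
  have hccv : Valued.v (jE ϖ ^ j * (α - ρ α)) = Valued.v (jE ϖ) ^ j := by rw [Valuation.map_mul, hU, mul_one, Valuation.map_pow]
  -- the depth letters in `|ϖE|`-powers
  have hμv : Valued.v (lam - jE ((u : Matrix (Fin 1) (Fin 1) E) 0 0)) = Valued.v (jE ϖ) ^ (2 * b) := by
    rw [hπn, show ((2 * b : ℕ) : ℤ) = m by exact_mod_cast hbm]; exact hm
  have hμρv : Valued.v ((lam - jE ((u : Matrix (Fin 1) (Fin 1) E) 0 0)) - ρ (lam - jE ((u : Matrix (Fin 1) (Fin 1) E) 0 0))) = Valued.v (jE ϖ) ^ (j + b) := by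
    rw [hπn, show ((j + b : ℕ) : ℤ) = jl by exact_mod_cast hjb]; exact hjl
  have hlamρ : lam - ρ lam = (lam - jE ((u : Matrix (Fin 1) (Fin 1) E) 0 0)) - ρ (lam - jE ((u : Matrix (Fin 1) (Fin 1) E) 0 0)) := by
    rw [map_sub, hρj]; ring
  -- the deep tokens at depth `4 = 3d − 2 + d%2`
  have hlam4 : Valued.v (lam - 1) ≤ Valued.v (jE ϖ) ^ 4 := by
    refine hlam1.trans ?_
    rw [Valuation.map_pow]; exact pow_le_pow_right_of_le_one' hjϖle (hN 2 tE _)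
  have hu4 : Valued.v ((u : Matrix (Fin 1) (Fin 1) E) 0 0 - 1) ≤ Valued.v ϖ ^ 4 := by
    refine hu1N.trans ?_
    rw [Valuation.map_pow]; exact pow_le_pow_right_of_le_one' hϖlt.le (hN 2 tE _)
  have hu1 : Valued.v ((u : Matrix (Fin 1) (Fin 1) E) 0 0 - 1) ≤ Valued.v ϖ := hu4.trans (by
    calc Valued.v ϖ ^ 4 ≤ Valued.v ϖ ^ 1 := pow_le_pow_right_of_le_one' hϖlt.le (by norm_num)
      _ = Valued.v ϖ := pow_one _)
  have hule : Valued.v ((u : Matrix (Fin 1) (Fin 1) E) 0 0) ≤ 1 := le_of_eq hu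
  -- ### M-side frame letters: `hFgap`, `hFN`, `hN4`/`hdeep`, the `Θ`-fixed valuation clause, the pivot `θ₀`
  have hFgap := v_eq_one_of_fixed_fixed (ρ := ρ) (Θ := Θ) hD jE hjiso hjfix hΘj
  have hFN := forall_fixed_fixed_exists_mul_theta_eq_of_frame hρρ hvρ hΘρ hα1 hU hDM hq hσres hτ
  obtain ⟨-, -, -, hfixΘ, -⟩ := id hDM
  have hN4 : ∀ u' : M, Θ u' = u' → Valued.v (u' - 1) ≤ Valued.v (jE ϖ) ^ 4 → ∃ z : M, z * Θ z = u' :=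
    fun u' hΘu hu1' => exists_mul_map_eq_of_fixed_of_v_sub_one_le_pred hDM hΘu (n := 4) (by norm_num) hu1'
  have hdeep : ∀ {n : ℕ}, 3 ≤ n → ∀ u' : M, ρ u' = u' → Θ u' = u' → Valued.v (u' - 1) ≤ Valued.v (jE ϖ) ^ n → ∃ c : M, ρ c = c ∧ c * Θ c = u' := by
    intro n hn u' hρu hΘu hu1'
    obtain ⟨ue, rfl⟩ := (hjfix u').1 hρu
    have hσue : σ ue = ue := jE.injective (by rw [← hΘj, hΘu])
    have hue1 : Valued.v (ue - 1) ≤ Valued.v ϖ ^ n := by rw [← hjiso, map_sub, map_one, ← hjiso ϖ]; exact hu1'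
    obtain ⟨z, hz⟩ := exists_mul_map_eq_of_fixed_of_v_sub_one_le_pred hD hσue (n := n) (by omega) hue1
    exact ⟨jE z, hρj z, by rw [hΘj, ← map_mul, hz]⟩
  obtain ⟨hΘθ₀, hθ1, hθρ⟩ := theta0_letters (ρ := ρ) hvρ hΘΘ hvΘ hα1 hU hτ h2M
  have hθρ0 : α * Θ α - ρ (α * Θ α) ≠ 0 := fun h0 => by rw [h0, map_zero] at hθρ; exact zero_ne_one hθρ
  -- ### the parity of `δ = jl − m` and the reference pair `(κ₀, ξ₀)` at the cell's radius
  have hjl2 : jl % 2 = 0 := by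
    have := antiDepth_mod_two_eq jE hΘρ hDM hΘlam hvlam hvρ (by rw [hlamρ]; exact hjl) (by omega); omega
  obtain ⟨δ₂, hδ₂⟩ : ∃ δ₂ : ℕ, j = b + 2 * δ₂ := ⟨(jl - m) / 2, by omega⟩
  have hδ₂1 : 1 ≤ δ₂ := by omega
  obtain ⟨κ₀, hκ₀def⟩ : ∃ κ₀ : M, κ₀ = α * Θ α / (α * Θ α - ρ (α * Θ α)) := ⟨_, rfl⟩
  obtain ⟨ξ₀, hξ₀def⟩ : ∃ ξ₀ : M, ξ₀ = jE (((ϖ * σ ϖ) ^ δ₂)⁻¹) * (α * Θ α - ρ (α * Θ α)) := ⟨_, rfl⟩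
  have hκ₀ : κ₀ + ρ κ₀ = 1 := by
    rw [hκ₀def, map_div₀, map_sub, hρρ, ← neg_sub (α * Θ α) (ρ (α * Θ α)), div_neg, ← sub_eq_add_neg, ← sub_div, div_self hθρ0]
  have hΘρθ : Θ (ρ (α * Θ α)) = ρ (α * Θ α) := by rw [hΘρ, hΘθ₀]
  have hΘκ₀ : Θ κ₀ = κ₀ := by rw [hκ₀def, map_div₀, map_sub, hΘθ₀, hΘρθ]
  have hπσ : σ (ϖ * σ ϖ) = ϖ * σ ϖ := by rw [map_mul, hσσ, mul_comm]
  have hξ : ρ ξ₀ = -ξ₀ := by rw [hξ₀def, map_mul, hρj, map_sub, hρρ]; ring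
  have hΘξ : Θ ξ₀ = ξ₀ := by rw [hξ₀def, map_mul, hΘj, map_inv₀ σ, map_pow, hπσ, map_sub, hΘθ₀, hΘρθ]
  have hξv : Valued.v ξ₀ = Valued.v (jE ϖ) ^ (-(2 * (δ₂ : ℤ))) := by
    rw [hξ₀def, Valuation.map_mul, hθρ, mul_one, map_inv₀, Valuation.map_inv, map_pow, Valuation.map_pow, map_mul, Valuation.map_mul,
      ← hΘj, hvΘ, ← pow_two, ← pow_mul, ← zpow_natCast, ← zpow_neg]
    congr 1
  have hξpos : (0 : ℤᵐ⁰) < Valued.v ξ₀ := by rw [hξv]; exact zpow_pos (zero_lt_iff.2 hvjϖ0) _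
  have hξ0 : ξ₀ ≠ 0 := fun h0 => by rw [h0, map_zero] at hξpos; exact lt_irrefl _ hξpos
  have hξ1 : 1 < Valued.v ξ₀ := by
    have h2δ : (0 : ℤ) < 2 * (δ₂ : ℤ) := by omega
    rw [hξv, ← hπz, ← exp_zero]; exact exp_lt_exp.2 h2δ
  have hRξ : Valued.v ξ₀ * Valued.v (jE ϖ ^ j * (α - ρ α)) = Valued.v (jE ϖ) ^ b := by
    rw [hξv, hccv, ← zpow_natCast, ← zpow_add₀ hvjϖ0, ← zpow_natCast]; congr 1; omega
  have hκ₀v : Valued.v κ₀ ≤ Valued.v ξ₀ := by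
    rw [hκ₀def, map_div₀, hθρ, div_one]; exact hθ1.trans hξ1.le
  have hRle : Valued.v (jE ϖ) ^ b ≤ Valued.v ξ₀ * Valued.v (jE ϖ ^ j * (α - ρ α)) := le_of_eq hRξ.symm
  -- the reference scalars `R₀, γ₀` and the `E`-decomposition `μ = jE μ_a + jE μ_b α`
  obtain ⟨R₀, hR₀⟩ : ∃ R₀ : E, jE R₀ = α * κ₀ + ρ (α * κ₀) := (hjfix _).1 (by rw [map_add, hρρ, add_comm])
  obtain ⟨γ₀, hγ₀⟩ : ∃ γ₀ : E, jE γ₀ = ξ₀ * (α - ρ α) := (hjfix _).1 (trace_gen_mul_affine (α := α) hρρ (κ₀ := κ₀) (map_one ρ) hξ).2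
  obtain ⟨μb, hμb⟩ : ∃ μb : E, jE μb = ((lam - jE ((u : Matrix (Fin 1) (Fin 1) E) 0 0)) - ρ (lam - jE ((u : Matrix (Fin 1) (Fin 1) E) 0 0))) / (α - ρ α) := (hjfix _).1 (by
    have e1 : ρ (((lam - jE ((u : Matrix (Fin 1) (Fin 1) E) 0 0)) - ρ (lam - jE ((u : Matrix (Fin 1) (Fin 1) E) 0 0))) / (α - ρ α)) = (ρ (lam - jE ((u : Matrix (Fin 1) (Fin 1) E) 0 0)) - (lam - jE ((u : Matrix (Fin 1) (Fin 1) E) 0 0))) / (ρ α - α) := by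
      rw [map_div₀, map_sub ρ (lam - jE ((u : Matrix (Fin 1) (Fin 1) E) 0 0)), hρρ, map_sub ρ α, hρρ]
    rw [e1, ← neg_sub (lam - jE ((u : Matrix (Fin 1) (Fin 1) E) 0 0)), ← neg_sub α, neg_div_neg_eq])
  obtain ⟨μa, hμa⟩ : ∃ μa : E, jE μa = (lam - jE ((u : Matrix (Fin 1) (Fin 1) E) 0 0)) - jE μb * α := (hjfix _).1 (by
    rw [map_sub ρ (lam - jE ((u : Matrix (Fin 1) (Fin 1) E) 0 0)), map_mul, hρj, hμb]; field_simp; ring)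
  have hμab : (lam - jE ((u : Matrix (Fin 1) (Fin 1) E) 0 0)) = jE μa + jE μb * α := by rw [hμa]; ring
  -- sizes: `|μ_b| = |ϖE|^{j+b}`, `|μ_a| ≤ |ϖE|^{2b}`, `|R₀| ≤ 1`, `|γ₀| = |ξ₀|`
  have hμbv : Valued.v (jE μb) = Valued.v (jE ϖ) ^ (j + b) := by rw [hμb, map_div₀, hμρv, hU, div_one]
  have hμav : Valued.v (jE μa) ≤ Valued.v (jE ϖ) ^ (2 * b) := by
    rw [hμa]
    refine (Valuation.map_sub _ _ _).trans (max_le (le_of_eq hμv) ?_)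
    rw [Valuation.map_mul, hμbv]
    calc Valued.v (jE ϖ) ^ (j + b) * Valued.v α ≤ Valued.v (jE ϖ) ^ (j + b) * 1 := mul_le_mul' le_rfl hα1
      _ ≤ Valued.v (jE ϖ) ^ (2 * b) := by rw [mul_one]; exact pow_le_pow_right_of_le_one' hjϖle (by omega)
  have hR₀v : Valued.v (jE R₀) ≤ 1 := by
    rw [hR₀]
    refine (Valuation.map_add _ _ _).trans (max_le ?_ ?_)
    · rw [Valuation.map_mul]; exact mul_le_one' hα1 (by rw [hκ₀def, map_div₀, hθρ, div_one]; exact hθ1)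
    · rw [hvρ, Valuation.map_mul]; exact mul_le_one' hα1 (by rw [hκ₀def, map_div₀, hθρ, div_one]; exact hθ1)
  have hγ₀v : Valued.v (jE γ₀) = Valued.v ξ₀ := by rw [hγ₀, Valuation.map_mul, hU, mul_one]
  have hPv : Valued.v ((ϖ * σ ϖ) ^ b) = Valued.v ϖ ^ (2 * b) := by rw [Valuation.map_pow, Valuation.map_mul, hvσ, ← pow_two, ← pow_mul, mul_comm]
  have hP0 : (ϖ * σ ϖ) ^ b ≠ 0 := pow_ne_zero _ (mul_ne_zero hϖ0 ((map_ne_zero σ).2 hϖ0))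
  have hâ : Valued.v (μa + μb * R₀) ≤ Valued.v ϖ ^ (2 * b) := by
    rw [← hjiso, map_add, map_mul, ← hjiso ϖ]
    refine (Valuation.map_add _ _ _).trans (max_le hμav ?_)
    rw [Valuation.map_mul, hμbv]
    calc Valued.v (jE ϖ) ^ (j + b) * Valued.v (jE R₀) ≤ Valued.v (jE ϖ) ^ (j + b) * 1 := mul_le_mul' le_rfl hR₀v
      _ ≤ Valued.v (jE ϖ) ^ (2 * b) := by rw [mul_one]; exact pow_le_pow_right_of_le_one' hjϖle (by omega)
  have hbh : Valued.v (μb * γ₀) = Valued.v ϖ ^ (2 * b) := by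
    rw [← hjiso, map_mul, Valuation.map_mul, hμbv, hγ₀v, hξv, ← hjiso ϖ, ← zpow_natCast, ← zpow_add₀ hvjϖ0, ← zpow_natCast]
    congr 1; push_cast; omega
  have hâ1 : Valued.v ((μa + μb * R₀) * ((ϖ * σ ϖ) ^ b)⁻¹) ≤ 1 := by
    rw [Valuation.map_mul, map_inv₀, hPv, ← div_eq_mul_inv, div_le_one₀ (pow_pos (zero_lt_iff.2 hvϖ0) _)]; exact hâ
  have hbh1 : Valued.v (μb * γ₀ * ((ϖ * σ ϖ) ^ b)⁻¹) = 1 := by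
    rw [Valuation.map_mul, map_inv₀, hPv, hbh, mul_inv_cancel₀ (pow_ne_zero _ hvϖ0)]
  -- ### the affine letters (★ p864020) and the digit systems
  obtain ⟨α₁, γ₁, hσα₁, hα₁1, hσγ₁, hγ₁, hnx, haff⟩ := exists_affineLabel_of_coords_depthZero hD hd0 hâ1 hbh1
  obtain ⟨Rd, hRd1, hRd2, hRd3, -⟩ := exists_repr_fixedBall_card hσσ hvσ hfixE hϖ hdd (2 * 2) 0
  obtain ⟨R', hR'1, hR'2, hR'3, -⟩ := exists_repr_fixedBall_card hσσ hvσ hfixE hϖ hdd 2 0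
  simp only [mul_zero, pow_zero, add_zero] at hRd1 hRd2 hRd3 hR'1 hR'2 hR'3
  -- ### the depth clause on the `u`-free cell
  have hdepG : ∀ (Λ : AddSubgroup M) (x₀ : M), (x₀ ≠ 0 ∧ (∀ x, x ∈ Λ ↔ ∃ ζ, IsOrd ρ α (jE ϖ ^ j) ζ ∧ x = x₀ * ζ) ∧
      IsOrd ρ α (jE ϖ ^ j) (dualGen ρ Θ α (jE ϖ ^ j) h x₀) ∧ ¬ IsOrd ρ α (jE ϖ ^ j) (dualGen ρ Θ α (jE ϖ ^ j) h x₀ / jE ϖ) ∧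
      Valued.v (dualGen ρ Θ α (jE ϖ ^ j) h x₀) = Valued.v (jE ϖ) ^ b) →
      Λ ∈ levelSetDep ρ Θ α (jE ϖ) h j b (lam - jE ((u : Matrix (Fin 1) (Fin 1) E) 0 0)) ∧ IsOrd ρ α (jE ϖ ^ j) ((lam - jE ((u : Matrix (Fin 1) (Fin 1) E) 0 0)) / dualGen ρ Θ α (jE ϖ ^ j) h x₀) := by
    rintro Λ x₀ hG
    have hΛ : Λ ∈ levelSetDep ρ Θ α (jE ϖ) h j b (lam - jE ((u : Matrix (Fin 1) (Fin 1) E) 0 0)) := by rw [hcell]; exact ⟨x₀, hG⟩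
    exact ⟨hΛ, (forall_herm_mul_mem_iff_isOrd_div hρρ hvρ hα hα1 hint hΘΘ hΘρ hvΘ hc hc0 hc1 hh hG.1 hG.2.1 (lam - jE ((u : Matrix (Fin 1) (Fin 1) E) 0 0))).1 hΛ.2⟩
  -- ### (hV), (hP) — LH4-p16 (g2)'s ★ p863914
  have hV : ∀ (Λ : AddSubgroup M) (x₀ : M), (x₀ ≠ 0 ∧ (∀ x, x ∈ Λ ↔ ∃ ζ, IsOrd ρ α (jE ϖ ^ j) ζ ∧ x = x₀ * ζ) ∧ IsOrd ρ α (jE ϖ ^ j) (dualGen ρ Θ α (jE ϖ ^ j) h x₀) ∧ ¬ IsOrd ρ α (jE ϖ ^ j) (dualGen ρ Θ α (jE ϖ ^ j) h x₀ / jE ϖ) ∧ Valued.v (dualGen ρ Θ α (jE ϖ ^ j) h x₀) = Valued.v (jE ϖ) ^ b) →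
      ∃ Ve : E, jE Ve = (((ρ (h * (x₀ * Θ x₀)) / ((h * (x₀ * Θ x₀)) + ρ (h * (x₀ * Θ x₀)))) - κ₀) / ξ₀) ∧ σ Ve = Ve ∧ Valued.v Ve ≤ 1 :=
    fun Λ x₀ hG => exists_coord_of_gen hD jE hjv hjfix hΘj hρρ hvρ hΘΘ hΘρ hΘh hb hcc hFgap hκ₀ hΘκ₀ hξ hΘξ hξ0 hκ₀v hRle Λ x₀ hG
  have hPread : ∀ (Λ : AddSubgroup M) (x₀ : M), (x₀ ≠ 0 ∧ (∀ x, x ∈ Λ ↔ ∃ ζ, IsOrd ρ α (jE ϖ ^ j) ζ ∧ x = x₀ * ζ) ∧ IsOrd ρ α (jE ϖ ^ j) (dualGen ρ Θ α (jE ϖ ^ j) h x₀) ∧ ¬ IsOrd ρ α (jE ϖ ^ j) (dualGen ρ Θ α (jE ϖ ^ j) h x₀ / jE ϖ) ∧ Valued.v (dualGen ρ Θ α (jE ϖ ^ j) h x₀) = Valued.v (jE ϖ) ^ b) → (f b j Λ ≠ 0 ↔ ((∃ e : M, ρ e = e ∧ e * Θ e = (h * (x₀ * Θ x₀)) + ρ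 (h * (x₀ * Θ x₀))) ↔ (∃ e : M, ρ e = e ∧ e * Θ e = -(h * ρ h * ((α - ρ α) * Θ (α - ρ α)) * jE hW)))) :=
    fun Λ x₀ hG => weight_ne_zero_iff_cls_of_gen (α := α) hD h2v jE hjv hjfix hΘj hρρ hvρ hΘΘ hΘρ hvΘ hΘh hh hb hdb hcc hFgap hhWσ hhW1 hlamj f hf hcell Λ x₀ hG
  -- ### (hI) — ★ p863952 at `τ₀ = |ϖE|^(j+1)`, `η = |ϖE|³`, and the parity of fixed valuations
  have hΘα : Valued.v (Θ α - α) ≤ Valued.v (jE ϖ) := by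
    rw [← Valuation.map_neg, neg_sub]; exact v_le_uniformizer_of_lt_one hϖM hτ
  have hI := cls_iff_and_digit_sub_le_of_gens (σ := σ) (ρ := ρ) (Θ := Θ) (α := α) hdb hbj hδ₂ hD hσσ hvσ hϖ hjv hjiso hjfix hΘj hρρ hvρ hα hα1 hΘΘ hΘρ hvΘ hΘh hb hjϖ0 hvjϖ0 hjϖlt hjϖle hvϖ0 hπσ hρϖ hcc hclt hFgap hdeep hΘα hκ₀ hΘκ₀ hξ hΘξ hξ0 hξpos hξv hRξ hκ₀v hRle
  -- ### the radius `r = |ϖ|⁴` and the digit systems, normalised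
  have hr4 : Valued.v ϖ ^ 4 = Valued.v (jE ϖ) ^ 4 := by rw [hjiso]
  have hRd2' : ∀ V : E, σ V = V → Valued.v V ≤ 1 → ∃ V₀ ∈ Rd, Valued.v (V - V₀) ≤ Valued.v ϖ ^ 4 := by simpa using hRd2
  have hRd3' : ∀ V ∈ Rd, ∀ V' ∈ Rd, Valued.v (V - V') ≤ Valued.v ϖ ^ 4 → V = V' := by simpa using hRd3
  have hR'2' : ∀ V : E, σ V = V → Valued.v V ≤ 1 → ∃ V₀ ∈ R', Valued.v (V - V₀) ≤ Valued.v ϖ ^ 2 := by simpa using hR'2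
  have hR'3' : ∀ V ∈ R', ∀ V' ∈ R', Valued.v (V - V') ≤ Valued.v ϖ ^ 2 → V = V' := by simpa using hR'3
  have h42 : Valued.v ϖ ^ 4 ≤ Valued.v ϖ ^ 2 := pow_le_pow_right_of_le_one' hϖlt.le (by norm_num)
  have hdist : ∀ (κ : M) (V : E), Valued.v ((κ - κ₀) / ξ₀ - jE V) ≤ Valued.v ϖ ^ 4 ↔ Valued.v (κ - (κ₀ + jE V * ξ₀)) ≤ Valued.v ϖ ^ 4 * Valued.v ξ₀ := by
    intro κ V
    have e : (κ - κ₀) / ξ₀ - jE V = (κ - (κ₀ + jE V * ξ₀)) / ξ₀ := by field_simp; ring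
    rw [e, map_div₀, div_le_iff₀ hξpos]
  -- ### (hLit): a digit near a vertex digit is on the sphere and realisable from the vertex (★ T-b5b §2)
  have hLit : ∀ (Λ : AddSubgroup M) (x₀ : M) (V₀ : E), (x₀ ≠ 0 ∧ (∀ x, x ∈ Λ ↔ ∃ ζ, IsOrd ρ α (jE ϖ ^ j) ζ ∧ x = x₀ * ζ) ∧ IsOrd ρ α (jE ϖ ^ j) (dualGen ρ Θ α (jE ϖ ^ j) h x₀) ∧ ¬ IsOrd ρ α (jE ϖ ^ j) (dualGen ρ Θ α (jE ϖ ^ j) h x₀ / jE ϖ) ∧ Valued.v (dualGen ρ Θ α (jE ϖ ^ j) h x₀) = Valued.v (jE ϖ) ^ b) → V₀ ∈ Rd →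
      Valued.v ((((ρ (h * (x₀ * Θ x₀)) / ((h * (x₀ * Θ x₀)) + ρ (h * (x₀ * Θ x₀)))) - κ₀) / ξ₀) - jE V₀) ≤ Valued.v ϖ ^ 4 → (Valued.v (κ₀ + jE V₀ * ξ₀) * Valued.v (jE ϖ ^ j * (α - ρ α)) = Valued.v (jE ϖ) ^ b ∧ ∃ (Λ : AddSubgroup M) (x₀ : M), (x₀ ≠ 0 ∧ (∀ x, x ∈ Λ ↔ ∃ ζ, IsOrd ρ α (jE ϖ ^ j) ζ ∧ x = x₀ * ζ) ∧ IsOrd ρ α (jE ϖ ^ j) (dualGen ρ Θ α (jE ϖ ^ j) h x₀) ∧ ¬ IsOrd ρ α (jE ϖ ^ j) (dualGen ρ Θ α (jE ϖ ^ j) h x₀ / jE ϖ) ∧ Valued.v (dualGen ρ Θ α (jE ϖ ^ j) h x₀) = Valued.v (jE ϖ) ^ b) ∧ ∃ z : M, z * Θ z = ρ (κ₀ + jE V₀ * ξ₀) / ρ (ρ (h * (x₀ * Θ x₀)) / ((h * (x₀ * Θ x₀)) + ρ (h * (x₀ * Θ x₀))))) := by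
    intro Λ x₀ V₀ hG hV₀ hnear
    have hσV₀ : σ V₀ = V₀ := (hRd1 V₀ hV₀).1
    obtain ⟨hs, hz⟩ := sphere_and_flip_of_near (α := α) hρρ hvρ hΘΘ hΘρ hΘh hh hρϖ hjϖ0 hjϖle hjϖlt hb hcc hFgap hN4 hΘκ₀ hΘξ hRξ hG.1 hG.2.2.1
      hG.2.2.2.1 hG.2.2.2.2 (W₀ := jE V₀) (by rw [hΘj, hσV₀]) (r := Valued.v ϖ ^ 4) (le_of_eq hr4) ((hdist _ V₀).1 hnear)
    exact ⟨hs, Λ, x₀, hG, hz⟩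
  -- ### (hNX), (hψ): the label predicates are class functions
  have hNX : ∀ Ve V₀ : E, σ Ve = Ve → Valued.v Ve ≤ 1 → V₀ ∈ Rd → Valued.v (Ve - V₀) ≤ Valued.v ϖ ^ 4 → ((Valued.v (α₁ + γ₁ * Ve) = 1) ↔ (Valued.v (α₁ + γ₁ * V₀) = 1)) :=
    fun Ve V₀ _ _ _ hnear => v_affine_eq_one_iff_of_near hϖlt hγ₁.le (hnear.trans h42)
  have hψ : ∀ Ve V₀ : E, σ Ve = Ve → Valued.v Ve ≤ 1 → V₀ ∈ Rd → Valued.v (Ve - V₀) ≤ Valued.v ϖ ^ 4 → (((Valued.v (α₁ + γ₁ * Ve) = 1) ∧ normSign σ (α₁ + γ₁ * Ve) = normSign σ (-hW)) ↔ ((Valued.v (α₁ + γ₁ * V₀) = 1) ∧ normSign σ (α₁ + γ₁ * V₀) = normSign σ (-hW))) := by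
    intro Ve V₀ hσVe hVe1 hV₀ hnear
    have hσV₀ : σ V₀ = V₀ := (hRd1 V₀ hV₀).1
    constructor
    · rintro ⟨hnx, hω⟩
      refine ⟨(hNX Ve V₀ hσVe hVe1 hV₀ hnear).1 hnx, ?_⟩
      rw [normSign_affine_eq_of_near hD hσα₁ hσγ₁ hγ₁.le hσVe hσV₀ (n := 4) (by norm_num) hnear hnx]; exact hω
    · rintro ⟨hnx, hω⟩
      have hnx' : (Valued.v (α₁ + γ₁ * Ve) = 1) := (hNX Ve V₀ hσVe hVe1 hV₀ hnear).2 hnx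
      refine ⟨hnx', ?_⟩
      rw [← normSign_affine_eq_of_near hD hσα₁ hσγ₁ hγ₁.le hσVe hσV₀ (n := 4) (by norm_num) hnear hnx']; exact hω
  -- ### (hbase): ★ p863899 HEAD′, `LIT` constant on `|V − V′| ≤ |ϖ|²` (★ T-b5b §3)
  have hLITc : ∀ V V' : E, σ V = V → Valued.v V ≤ 1 → σ V' = V' → Valued.v V' ≤ 1 → Valued.v (V - V') ≤ Valued.v ϖ ^ 2 →
      ((Valued.v (κ₀ + jE V * ξ₀) * Valued.v (jE ϖ ^ j * (α - ρ α)) = Valued.v (jE ϖ) ^ b ∧ ∃ (Λ : AddSubgroup M) (x₀ : M), (x₀ ≠ 0 ∧ (∀ x, x ∈ Λ ↔ ∃ ζ, IsOrd ρ α (jE ϖ ^ j) ζ ∧ x = x₀ * ζ) ∧ IsOrd ρ α (jE ϖ ^ j) (dualGen ρ Θ α (jE ϖ ^ j) h x₀) ∧ ¬ IsOrd ρ α (jE ϖ ^ j) (dualGen ρ Θ α (jE ϖ ^ j) h x₀ / jE ϖ) ∧ Valued.v (dualGen ρ Θ α (jE ϖ ^ j) h x₀) = Valued.v (jE ϖ)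 ^ b) ∧ ∃ z : M, z * Θ z = ρ (κ₀ + jE V * ξ₀) / ρ (ρ (h * (x₀ * Θ x₀)) / ((h * (x₀ * Θ x₀)) + ρ (h * (x₀ * Θ x₀))))) ↔ (Valued.v (κ₀ + jE V' * ξ₀) * Valued.v (jE ϖ ^ j * (α - ρ α)) = Valued.v (jE ϖ) ^ b ∧ ∃ (Λ : AddSubgroup M) (x₀ : M), (x₀ ≠ 0 ∧ (∀ x, x ∈ Λ ↔ ∃ ζ, IsOrd ρ α (jE ϖ ^ j) ζ ∧ x = x₀ * ζ) ∧ IsOrd ρ α (jE ϖ ^ j) (dualGen ρ Θ α (jE ϖ ^ j) h x₀) ∧ ¬ IsOrd ρ α (jE ϖ ^ j) (dualGen ρ Θ α (jE ϖ ^ j) h x₀ / jE ϖ) ∧ Valued.v (dualGen ρ Θ α (jE ϖ ^ j) h x₀) = Valued.v (jE ϖ) ^ b) ∧ ∃ z : M, z * Θ z = ρ (κ₀ + jE V' * ξ₀) / ρ (ρ (h * (x₀ * Θ x₀)) / ((h * (x₀ * Θ x₀)) + ρ (h * (x₀ * Θ x₀)))))) := by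
    have hmove : ∀ V V' : E, σ V = V → σ V' = V' → Valued.v (V - V') ≤ Valued.v ϖ ^ 2 → (Valued.v (κ₀ + jE V * ξ₀) * Valued.v (jE ϖ ^ j * (α - ρ α)) = Valued.v (jE ϖ) ^ b ∧ ∃ (Λ : AddSubgroup M) (x₀ : M), (x₀ ≠ 0 ∧ (∀ x, x ∈ Λ ↔ ∃ ζ, IsOrd ρ α (jE ϖ ^ j) ζ ∧ x = x₀ * ζ) ∧ IsOrd ρ α (jE ϖ ^ j) (dualGen ρ Θ α (jE ϖ ^ j) h x₀) ∧ ¬ IsOrd ρ α (jE ϖ ^ j) (dualGen ρ Θ α (jE ϖ ^ j) h x₀ / jE ϖ) ∧ Valued.v (dualGen ρ Θ α (jE ϖ ^ j) h x₀) = Valued.v (jE ϖ) ^ b) ∧ ∃ z : M, z * Θ z = ρ (κ₀ + jE V * ξ₀) / ρ (ρ (h * (x₀ * Θ x₀)) / ((h * (x₀ * Θ x₀)) + ρ (h * (x₀ * Θ x₀))))) → (Valued.v (κ₀ + jE V' * ξ₀) * Valued.v (jE ϖ ^ j * (α - ρ α)) = Valued.v (jE ϖ) ^ b ∧ ∃ (Λ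 : AddSubgroup M) (x₀ : M), (x₀ ≠ 0 ∧ (∀ x, x ∈ Λ ↔ ∃ ζ, IsOrd ρ α (jE ϖ ^ j) ζ ∧ x = x₀ * ζ) ∧ IsOrd ρ α (jE ϖ ^ j) (dualGen ρ Θ α (jE ϖ ^ j) h x₀) ∧ ¬ IsOrd ρ α (jE ϖ ^ j) (dualGen ρ Θ α (jE ϖ ^ j) h x₀ / jE ϖ) ∧ Valued.v (dualGen ρ Θ α (jE ϖ ^ j) h x₀) = Valued.v (jE ϖ) ^ b) ∧ ∃ z : M, z * Θ z = ρ (κ₀ + jE V' * ξ₀) / ρ (ρ (h * (x₀ * Θ x₀)) / ((h * (x₀ * Θ x₀)) + ρ (h * (x₀ * Θ x₀))))) := by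
      rintro V V' hσV hσV' hnear ⟨hs, Λ, x₀, hG, hz⟩
      have hnear' : Valued.v (jE V' - jE V) ≤ Valued.v (jE ϖ) ^ 2 := by rw [← map_sub, hjiso, Valuation.map_sub_swap, hjiso]; exact hnear
      obtain ⟨hs', hz'⟩ := sphere_and_flip_of_sub_le (α := α) hρρ hvρ hΘΘ hΘρ hvΘ h2M hϖM hρϖ hfixΘ hFN hN4 hκ₀ hΘκ₀ hξ hΘξ hξ1 hRξ
        (hρj V) (by rw [hΘj, hσV]) (hρj V') (by rw [hΘj, hσV']) hnear' hs hz
      exact ⟨hs', Λ, x₀, hG, hz'⟩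
    intro V V' hσV _ hσV' _ hnear
    exact ⟨hmove V V' hσV hσV' hnear, hmove V' V hσV' hσV (by rw [Valuation.map_sub_swap]; exact hnear)⟩
  have hbase : (((Rd.filter fun V => (Valued.v (κ₀ + jE V * ξ₀) * Valued.v (jE ϖ ^ j * (α - ρ α)) = Valued.v (jE ϖ) ^ b ∧ ∃ (Λ : AddSubgroup M) (x₀ : M), (x₀ ≠ 0 ∧ (∀ x, x ∈ Λ ↔ ∃ ζ, IsOrd ρ α (jE ϖ ^ j) ζ ∧ x = x₀ * ζ) ∧ IsOrd ρ α (jE ϖ ^ j) (dualGen ρ Θ α (jE ϖ ^ j) h x₀) ∧ ¬ IsOrd ρ α (jE ϖ ^ j) (dualGen ρ Θ α (jE ϖ ^ j) h x₀ / jE ϖ) ∧ Valued.v (dualGen ρ Θ α (jE ϖ ^ j) h x₀) = Valued.v (jE ϖ) ^ b) ∧ ∃ z : M, z * Θ z = ρ (κ₀ + jE V * ξ₀) / ρ (ρ (h * (x₀ * Θ x₀)) / ((h * (x₀ * Θ x₀)) + ρ (h * (x₀ * Θ x₀)))))).filter fun V => (Valued.v (α₁ + γ₁ * V) = 1)).filter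 fun V => ((Valued.v (α₁ + γ₁ * V) = 1) ∧ normSign σ (α₁ + γ₁ * V) = normSign σ (-hW))).card =
      (((Rd.filter fun V => (Valued.v (κ₀ + jE V * ξ₀) * Valued.v (jE ϖ ^ j * (α - ρ α)) = Valued.v (jE ϖ) ^ b ∧ ∃ (Λ : AddSubgroup M) (x₀ : M), (x₀ ≠ 0 ∧ (∀ x, x ∈ Λ ↔ ∃ ζ, IsOrd ρ α (jE ϖ ^ j) ζ ∧ x = x₀ * ζ) ∧ IsOrd ρ α (jE ϖ ^ j) (dualGen ρ Θ α (jE ϖ ^ j) h x₀) ∧ ¬ IsOrd ρ α (jE ϖ ^ j) (dualGen ρ Θ α (jE ϖ ^ j) h x₀ / jE ϖ) ∧ Valued.v (dualGen ρ Θ α (jE ϖ ^ j) h x₀) = Valued.v (jE ϖ) ^ b) ∧ ∃ z : M, z * Θ z = ρ (κ₀ + jE V * ξ₀) / ρ (ρ (h * (x₀ * Θ x₀)) / ((h * (x₀ * Θ x₀)) + ρ (h * (x₀ * Θ x₀)))))).filter fun V => (Valued.v (α₁ + γ₁ * V) = 1)).filter fun V => ¬ ((Valued.v (α₁ + γ₁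 * V) = 1) ∧ normSign σ (α₁ + γ₁ * V) = normSign σ (-hW))).card := by
    have key := card_filter_unitAffine_eq_sign_eq_card_filter_ne hD h2v (le_refl 2) hσα₁ hσγ₁ hγ₁ Rd hRd1 hRd2 hRd3 R' hR'1 hR'2' hR'3'
      (fun V => (Valued.v (κ₀ + jE V * ξ₀) * Valued.v (jE ϖ ^ j * (α - ρ α)) = Valued.v (jE ϖ) ^ b ∧ ∃ (Λ : AddSubgroup M) (x₀ : M), (x₀ ≠ 0 ∧ (∀ x, x ∈ Λ ↔ ∃ ζ, IsOrd ρ α (jE ϖ ^ j) ζ ∧ x = x₀ * ζ) ∧ IsOrd ρ α (jE ϖ ^ j) (dualGen ρ Θ α (jE ϖ ^ j) h x₀) ∧ ¬ IsOrd ρ α (jE ϖ ^ j) (dualGen ρ Θ α (jE ϖ ^ j) h x₀ / jE ϖ) ∧ Valued.v (dualGen ρ Θ α (jE ϖ ^ j) h x₀) = Valued.v (jE ϖ) ^ b) ∧ ∃ z : M, z * Θ z = ρ (κ₀ + jE V * ξ₀) / ρ (ρ (h * (x₀ * Θ x₀)) / ((h * (x₀ * Θ x₀)) + ρ (h * (x₀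 * Θ x₀)))))) hLITc (normSign_eq_one_or σ (-hW))
    have e1 : (((Rd.filter fun V => (Valued.v (κ₀ + jE V * ξ₀) * Valued.v (jE ϖ ^ j * (α - ρ α)) = Valued.v (jE ϖ) ^ b ∧ ∃ (Λ : AddSubgroup M) (x₀ : M), (x₀ ≠ 0 ∧ (∀ x, x ∈ Λ ↔ ∃ ζ, IsOrd ρ α (jE ϖ ^ j) ζ ∧ x = x₀ * ζ) ∧ IsOrd ρ α (jE ϖ ^ j) (dualGen ρ Θ α (jE ϖ ^ j) h x₀) ∧ ¬ IsOrd ρ α (jE ϖ ^ j) (dualGen ρ Θ α (jE ϖ ^ j) h x₀ / jE ϖ) ∧ Valued.v (dualGen ρ Θ α (jE ϖ ^ j) h x₀) = Valued.v (jE ϖ) ^ b) ∧ ∃ z : M, z * Θ z = ρ (κ₀ + jE V * ξ₀) / ρ (ρ (h * (x₀ * Θ x₀)) / ((h * (x₀ * Θ x₀)) + ρ (h * (x₀ * Θ x₀)))))).filter fun V => (Valued.v (α₁ + γ₁ * V) = 1)).filter fun V => ((Valued.v (α₁ + γ₁ * V) = 1) ∧ normSign σ (α₁ + γ₁ * V)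 = normSign σ (-hW))) =
        (((Rd.filter fun V => (Valued.v (κ₀ + jE V * ξ₀) * Valued.v (jE ϖ ^ j * (α - ρ α)) = Valued.v (jE ϖ) ^ b ∧ ∃ (Λ : AddSubgroup M) (x₀ : M), (x₀ ≠ 0 ∧ (∀ x, x ∈ Λ ↔ ∃ ζ, IsOrd ρ α (jE ϖ ^ j) ζ ∧ x = x₀ * ζ) ∧ IsOrd ρ α (jE ϖ ^ j) (dualGen ρ Θ α (jE ϖ ^ j) h x₀) ∧ ¬ IsOrd ρ α (jE ϖ ^ j) (dualGen ρ Θ α (jE ϖ ^ j) h x₀ / jE ϖ) ∧ Valued.v (dualGen ρ Θ α (jE ϖ ^ j) h x₀) = Valued.v (jE ϖ) ^ b) ∧ ∃ z : M, z * Θ z = ρ (κ₀ + jE V * ξ₀) / ρ (ρ (h * (x₀ * Θ x₀)) / ((h * (x₀ * Θ x₀)) + ρ (h * (x₀ * Θ x₀)))))).filter fun V => (Valued.v (α₁ + γ₁ * V) = 1)).filter fun V => normSign σ (α₁ + γ₁ * V) = normSign σ (-hW)) :=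
      Finset.filter_congr fun V hV => by rw [Finset.mem_filter] at hV; exact ⟨fun h => h.2, fun h => ⟨hV.2, h⟩⟩
    have e2 : (((Rd.filter fun V => (Valued.v (κ₀ + jE V * ξ₀) * Valued.v (jE ϖ ^ j * (α - ρ α)) = Valued.v (jE ϖ) ^ b ∧ ∃ (Λ : AddSubgroup M) (x₀ : M), (x₀ ≠ 0 ∧ (∀ x, x ∈ Λ ↔ ∃ ζ, IsOrd ρ α (jE ϖ ^ j) ζ ∧ x = x₀ * ζ) ∧ IsOrd ρ α (jE ϖ ^ j) (dualGen ρ Θ α (jE ϖ ^ j) h x₀) ∧ ¬ IsOrd ρ α (jE ϖ ^ j) (dualGen ρ Θ α (jE ϖ ^ j) h x₀ / jE ϖ) ∧ Valued.v (dualGen ρ Θ α (jE ϖ ^ j) h x₀) = Valued.v (jE ϖ) ^ b) ∧ ∃ z : M, z * Θ z = ρ (κ₀ + jE V * ξ₀) / ρ (ρ (h * (x₀ * Θ x₀)) / ((h * (x₀ * Θ x₀)) + ρ (h * (x₀ * Θ x₀)))))).filter fun V => (Valued.v (α₁ + γ₁ * V) = 1)).filter fun V => ¬ ((Valued.v (α₁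 + γ₁ * V) = 1) ∧ normSign σ (α₁ + γ₁ * V) = normSign σ (-hW))) =
        (((Rd.filter fun V => (Valued.v (κ₀ + jE V * ξ₀) * Valued.v (jE ϖ ^ j * (α - ρ α)) = Valued.v (jE ϖ) ^ b ∧ ∃ (Λ : AddSubgroup M) (x₀ : M), (x₀ ≠ 0 ∧ (∀ x, x ∈ Λ ↔ ∃ ζ, IsOrd ρ α (jE ϖ ^ j) ζ ∧ x = x₀ * ζ) ∧ IsOrd ρ α (jE ϖ ^ j) (dualGen ρ Θ α (jE ϖ ^ j) h x₀) ∧ ¬ IsOrd ρ α (jE ϖ ^ j) (dualGen ρ Θ α (jE ϖ ^ j) h x₀ / jE ϖ) ∧ Valued.v (dualGen ρ Θ α (jE ϖ ^ j) h x₀) = Valued.v (jE ϖ) ^ b) ∧ ∃ z : M, z * Θ z = ρ (κ₀ + jE V * ξ₀) / ρ (ρ (h * (x₀ * Θ x₀)) / ((h * (x₀ * Θ x₀)) + ρ (h * (x₀ * Θ x₀)))))).filter fun V => (Valued.v (α₁ + γ₁ * V) = 1)).filter fun V => ¬ normSign σ (α₁ + γ₁ * V) = normSign σ (-hW)) :=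
      Finset.filter_congr fun V hV => by rw [Finset.mem_filter] at hV; exact ⟨fun h hω => h ⟨hV.2, hω⟩, fun h hψV => h hψV.2⟩
    rw [e1, e2]; exact key
  -- ### (hF): fibres over two literal digits are equinumerous (★ T-b5b §1, §4 + LH4-p16's sphere transport)
  have hμsq : Valued.v (lam - jE ((u : Matrix (Fin 1) (Fin 1) E) 0 0)) ≤ (Valued.v (jE ϖ) ^ b) ^ 2 := by rw [hμv, ← pow_mul, mul_comm]
  have hF := ncard_fibre_eq_of_lits (σ := σ) (ρ := ρ) (Θ := Θ) (α := α) (hW := hW) hjiso hρj hΘj hρρ hvρ hΘΘ hΘρ hΘh hh hb hfin hϖlt hjϖ0 hjϖlt hjϖle hρϖ hcc hFgap hFN hdeep hκ₀ hΘκ₀ hξ hΘξ hξ0 hξpos hRξ hRd1 hr4 hμsq hdepG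
  -- ### every weighted member carries a glued vertex (★ `ncard_glueFibre_eq_natCard_normFibre_of_gen` + `hf`)
  have hglue := exists_glued_of_weight_ne_zero (σ := σ) (ρ := ρ) (Θ := Θ) (α := α) hσσ hvσ hϖ hH₂ hH₂σ hhW hhWσ hjv hjfix hΘj hρρ hvρ hα hα1 hint hΘΘ hΘρ hvΘ hjpow hϖmax hφs hφi hφo hφγ hvlam hΘh hh hform hb hlamj hf hϖ0 hϖlt hdepG
  -- ### PER VERTEX: ★ p864194 at the presentation, the sign constant of ★ p863914 §3, the digit moved to the given generator
  have hms : mstarOfRecord 2 = 3 := by decide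
  have hvert := reads_of_gen (σ := σ) (ρ := ρ) (Θ := Θ) (α := α) hbj hD hσσ hvσ hϖ h2v hH₂ hH₂σ hhW hhWσ hhW1 hjv hjiso hjfix hΘj hρρ hvρ hα hα1 hint hΘΘ hΘρ hvΘ hjpow hϖmax hφs hφi hφo hφγ hvlam hΘlam hΘh hh hform huu hU hb hdb hlamj hf hcell hϖlt hjϖ0 hvjϖ0 hjϖle hρϖ hc hc1 hcc hccv hFgap hms hd0 hμv hμρv hlamρ hlam4 hu4 hu1 hule hΘα h42 hκ₀ hΘκ₀ hξ hΘξ hξ0 hR₀ hγ₀ hμab hâ hbh hσα₁ hσγ₁ hγ₁ hnx haff hV hdepG hI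
  -- ### the two shells are the exact level `0` (★ fold at `k = 3, 4`)
  have hu3 : Valued.v (((u : Matrix (Fin 1) (Fin 1) E) 0 0) - 1) ≤ Valued.v (ϖ ^ 3) := by
    rw [Valuation.map_pow]; exact hu4.trans (pow_le_pow_right_of_le_one' hϖlt.le (by norm_num))
  have hu4' : Valued.v (((u : Matrix (Fin 1) (Fin 1) E) 0 0) - 1) ≤ Valued.v (ϖ ^ 4) := by rw [Valuation.map_pow]; exact hu4
  have hμk : ∀ k : ℕ, k ≤ 4 → Valued.v (lam - jE ((u : Matrix (Fin 1) (Fin 1) E) 0 0)) ≤ Valued.v (jE ϖ) ^ k := fun k hk => by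
    rw [hμv]; exact pow_le_pow_right_of_le_one' hjϖle (by omega)
  have hprodk : ∀ k : ℕ, k ≤ 4 → Valued.v (lam - jE ((u : Matrix (Fin 1) (Fin 1) E) 0 0)) * Valued.v ((lam - jE ((u : Matrix (Fin 1) (Fin 1) E) 0 0)) - ρ (lam - jE ((u : Matrix (Fin 1) (Fin 1) E) 0 0))) ≤ Valued.v (jE ϖ ^ j * (α - ρ α)) * Valued.v (jE ϖ) ^ b * Valued.v (jE ϖ) ^ k := fun k hk => by
    rw [hμv, hμρv, hccv, ← pow_add, ← pow_add, ← pow_add]; exact pow_le_pow_right_of_le_one' hjϖle (by omega)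
  have h20 : (2 : ℕ) % 2 = 0 := by decide
  simp only [h20]
  rw [levelSetDep_inter_shell_and_eq_exactLevel_of_prod σ hσσ hvσ hϖ hH₂ hH₂σ hhW jE hρρ hvρ hα hα1 hint hΘΘ hΘρ hvΘ hjv hjfix hjpow hϖmax φ hφs hφi hφo hφγ hvlam hΘh hh hform
      u 0 3 (mstarOfRecord 2) (by decide) hu3 hb hlamj (hμk 3 (by norm_num)) (hprodk 3 (by norm_num)),
    levelSetDep_inter_shell_and_eq_exactLevel_of_prod σ hσσ hvσ hϖ hH₂ hH₂σ hhW jE hρρ hvρ hα hα1 hint hΘΘ hΘρ hvΘ hjv hjfix hjpow hϖmax φ hφs hφi hφo hφγ hvlam hΘh hh hform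
      u 0 4 (mcOfRecord 2) (by decide) hu4' hb hlamj (hμk 4 le_rfl) (hprodk 4 le_rfl)]
  -- ### the three-way count socket ★ p863833
  refine cellDiff_eq_zero_of_fibration_reads₃ σ hσσ hvσ hϖ hD h2v hH₂σ hhW hhWσ jE hρρ hvρ hα hα1 hint hΘΘ hΘρ hvΘ hΘj hjv hjfix hjpow hϖmax φ hφs hφi hφo hφγ hvlam hΘh hh hform
    ((u : Matrix (Fin 1) (Fin 1) E) 0 0) hb hdb hlamj f hf hjiso hcell hfin (fun x₀ => (∃ e : M, ρ e = e ∧ e * Θ e = (h * (x₀ * Θ x₀)) + ρ (h * (x₀ * Θ x₀)))) (fun x₀ => (((ρ (h * (x₀ * Θ x₀)) / ((h * (x₀ * Θ x₀)) + ρ (h * (x₀ * Θ x₀)))) - κ₀) / ξ₀)) (∃ e : M, ρ e = e ∧ e * Θ e = -(h * ρ h * ((α - ρ α) * Θ (α - ρ α)) * jE hW)) (Valued.v ϖ ^ 4) Rd hRd2' hRd3'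
    (fun V => (Valued.v (κ₀ + jE V * ξ₀) * Valued.v (jE ϖ ^ j * (α - ρ α)) = Valued.v (jE ϖ) ^ b ∧ ∃ (Λ : AddSubgroup M) (x₀ : M), (x₀ ≠ 0 ∧ (∀ x, x ∈ Λ ↔ ∃ ζ, IsOrd ρ α (jE ϖ ^ j) ζ ∧ x = x₀ * ζ) ∧ IsOrd ρ α (jE ϖ ^ j) (dualGen ρ Θ α (jE ϖ ^ j) h x₀) ∧ ¬ IsOrd ρ α (jE ϖ ^ j) (dualGen ρ Θ α (jE ϖ ^ j) h x₀ / jE ϖ) ∧ Valued.v (dualGen ρ Θ α (jE ϖ ^ j) h x₀) = Valued.v (jE ϖ) ^ b) ∧ ∃ z : M, z * Θ z = ρ (κ₀ + jE V * ξ₀) / ρ (ρ (h * (x₀ * Θ x₀)) / ((h * (x₀ * Θ x₀)) + ρ (h * (x₀ * Θ x₀)))))) (fun V => (Valued.v (α₁ + γ₁ * V) = 1)) (fun V => ((Valued.v (α₁ + γ₁ * V) = 1) ∧ normSign σ (α₁ + γ₁ * V) = normSign σ (-hW))) hI hV hLit hNX hψ hF hbase _ _ hPread ?_ ?_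
  · -- (hL₁): the `X₊`-literal
    intro Λ x₀ hG hfne
    constructor
    · rintro ⟨B, hBΛ, L₃, hL, hLB, htube, ⟨-, hn1⟩, hVS⟩
      obtain ⟨Ve, hVe, -, -⟩ := hV Λ x₀ hG
      obtain ⟨-, h1, h2⟩ := hvert Λ x₀ hG hfne Ve hVe B L₃ hBΛ hL hLB htube
      have hnx := h1.1 hn1
      exact ⟨Ve, hVe, hnx, hnx, (h2 hnx).1 hVS⟩
    · rintro ⟨Ve, hVe, hnx, -, hω⟩
      obtain ⟨B, hBΛ, L₃, hL, hLB, htube⟩ := hglue Λ x₀ hG hfne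
      obtain ⟨h0, h1, h2⟩ := hvert Λ x₀ hG hfne Ve hVe B L₃ hBΛ hL hLB htube
      exact ⟨B, hBΛ, L₃, hL, hLB, htube, ⟨h0, h1.2 hnx⟩, (h2 hnx).2 hω⟩
  · -- (hL₂): the complementary literal
    intro Λ x₀ hG hfne
    constructor
    · rintro ⟨B, hBΛ, L₃, hL, hLB, htube, ⟨-, hn1⟩, hVS⟩
      obtain ⟨Ve, hVe, -, -⟩ := hV Λ x₀ hG
      obtain ⟨-, h1, h2⟩ := hvert Λ x₀ hG hfne Ve hVe B L₃ hBΛ hL hLB htube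
      have hnx := h1.1 hn1
      exact ⟨Ve, hVe, hnx, fun hψV => hVS ((h2 hnx).2 hψV.2)⟩
    · rintro ⟨Ve, hVe, hnx, hnψ⟩
      obtain ⟨B, hBΛ, L₃, hL, hLB, htube⟩ := hglue Λ x₀ hG hfne
      obtain ⟨h0, h1, h2⟩ := hvert Λ x₀ hG hfne Ve hVe B L₃ hBΛ hL hLB htube
      exact ⟨B, hBΛ, L₃, hL, hLB, htube, ⟨h0, h1.2 hnx⟩, fun hVS => hnψ ⟨hnx, (h2 hnx).1 hVS⟩⟩

end Summit.HodgeConjecture.HodgeConjecture.Cruxes.H413.F0P3cDyRamTermHolds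

end
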